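import Mathlib
import Summits.ResolutionOfSingularities.ResolutionOfSingularities.Theorems.WildQuotientsWildQuotientResolutionCyclicTransfer
import Summits.ResolutionOfSingularities.ResolutionOfSingularities.Theorems.WildQuotientsWildQuotientResolutionAffineQuotientData
import Summits.ResolutionOfSingularities.ResolutionOfSingularities.Theorems.WildQuotientsWildQuotientResolutionAffineQuotientEtale
import Summits.ResolutionOfSingularities.ResolutionOfSingularities.Theorems.WildQuotientsWildQuotientResolutionTwoBlocksOrder
import Summits.ResolutionOfSingularities.ResolutionOfSingularities.Theorems.WildQuotientsWildQuotientResolutionFixedPointsGraded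
import Literature.AlgebraicGeometry.Resolution.ProjectiveSpaceRegular
import HarnessLib

/-!
# `𝔸⁴/(J₂ ⊕ J₂)` has a resolution, GIVEN a terminal model (programme T of chain w45c: the assembly)

(crux stmt-ResolutionOfSingularities-15640 `WildQuotients.WildQuotientResolution`, line `Sketch`,
programme «INSTANTIATE T1» = `𝔸⁴/(J₂ ⊕ J₂)`; [OURS · L1 W4.5c] — NOT a statement of any
manuscript.)

The assembly step of target T `TwoBlocks.twoJordanBlocksFourfold_hasResolution`: for the
two-block automorphism `σ = J₂ ⊕ J₂` of `k[x₀,…,x₃]` (`σ x₁ = x₁ + x₀`, `σ x₃ = x₃ + x₂`, `x₀, x₂`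
fixed; order `p` in every characteristic `p`, `TwoBlocks.stub_twoBlocks_order`), the quotient
`𝔸⁴/⟨σ⟩ = Spec k[x]^σ` has a resolution of singularities AS SOON AS the action `ρ = (g ↦ Spec g⁻¹)`
of `⟨σ⟩` on `𝔸⁴` (`AffineQuotient.exists_specAction`) admits a Király–Lütkebohmert terminal
model — a `⟨σ⟩`-equivariant proper birational regular integral `V → 𝔸⁴` with a stable affine
cover and principal stalk augmentation ideals at fixed points (hypothesis `hmodel`, the
∃-body of `CyclicTransfer.CyclicDivisorialModelsLE`; supplied for `V = Bl_{(x₀,x₂)} 𝔸⁴` by the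
S4-scheme step of the programme). Proof: the affine quotient data of
`…AffineQuotientData` / `…AffineQuotientEtale` (finite, surjective, invariant, fibres = orbits,
étale over `D(x₀)` since `σʲ x₁ - x₁ = j x₀`, `dim = 4`) fed to the landed transfer
`CyclicTransfer.cyclicDivisorialTransfer_of_card`.

* `X_zero_mem_augIdeal` — `x₀` lies in the augmentation ideal of every `g ≠ 1` in `⟨σ⟩`;
* `twoJordanBlocksFourfold_hasResolution_of_model` — the assembly.
-/

-- single-problem summit: the doubled namespace component `ResolutionOfSingularities` is forced
set_option linter.dupNamespace false

noncomputable section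

open CategoryTheory AlgebraicGeometry TopologicalSpace MvPolynomial
open scoped Pointwise
open Literature.AlgebraicGeometry.Resolution

namespace Summit.ResolutionOfSingularities.ResolutionOfSingularities.Theorems.WildQuotientResolution.TwoBlocks

/-- **`x₀` lies in the augmentation ideal of every non-trivial element of `⟨σ⟩`** (`σ = J₂ ⊕ J₂`
over a field of characteristic `p`): for `g = σⁿ ≠ 1` one has `p ∤ n` and `g • x₁ - x₁ = n x₀`
with `n` invertible in `k`. [folklore] -/
theorem X_zero_mem_augIdeal (p : ℕ) (hp : p.Prime) (k : Type) [Field k] [CharP k p]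
    (σ : MvPolynomial (Fin 4) k ≃ₐ[k] MvPolynomial (Fin 4) k)
    (h0 : σ (X 0) = X 0) (h1 : σ (X 1) = X 1 + X 0)
    (h2 : σ (X 2) = X 2) (h3 : σ (X 3) = X 3 + X 2)
    (g : Subgroup.zpowers σ) (hg : g ≠ 1) :
    (X 0 : MvPolynomial (Fin 4) k) ∈
      Ideal.span (Set.range fun b : MvPolynomial (Fin 4) k => g • b - b) := by
  classical
  obtain ⟨hσp, -, -⟩ := stub_twoBlocks_order p hp k σ h0 h1 h2 h3
  -- `g = σ ^ n` with `p ∤ n`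
  have hfin : IsOfFinOrder σ := isOfFinOrder_iff_pow_eq_one.mpr ⟨p, hp.pos, hσp⟩
  obtain ⟨n, hn⟩ : (g : MvPolynomial (Fin 4) k ≃ₐ[k] MvPolynomial (Fin 4) k) ∈ Submonoid.powers σ :=
    hfin.mem_powers_iff_mem_zpowers.mpr g.2
  have hn' : σ ^ n = (g : MvPolynomial (Fin 4) k ≃ₐ[k] MvPolynomial (Fin 4) k) := hn
  have hndvd : ¬ p ∣ n := by
    rintro ⟨m, rfl⟩
    apply hg
    apply Subtype.ext
    change (g : MvPolynomial (Fin 4) k ≃ₐ[k] MvPolynomial (Fin 4) k) = 1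
    rw [← hn', pow_mul, hσp, one_pow]
  have hnk : (n : k) ≠ 0 := fun h => hndvd ((CharP.cast_eq_zero_iff k p n).mp h)
  -- `g • x₁ - x₁ = n x₀`
  obtain ⟨-, e1, -, -⟩ := twoBlocks_pow_apply_X k σ h0 h1 h2 h3 n
  have hsmul : g • (X 1 : MvPolynomial (Fin 4) k) - X 1 = (n : MvPolynomial (Fin 4) k) * X 0 := by
    change (g : MvPolynomial (Fin 4) k ≃ₐ[k] MvPolynomial (Fin 4) k) (X 1) - X 1 = _
    rw [← hn', e1]
    ring
  have hx0 : (X 0 : MvPolynomial (Fin 4) k) =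
      C ((n : k)⁻¹) * (g • (X 1 : MvPolynomial (Fin 4) k) - X 1) := by
    rw [hsmul, ← mul_assoc, ← map_natCast (C : k →+* MvPolynomial (Fin 4) k) n, ← map_mul,
      inv_mul_cancel₀ hnk, map_one, one_mul]
  rw [hx0]
  exact Ideal.mul_mem_left _ _ (Ideal.subset_span ⟨X 1, rfl⟩)

/-- **Assembly of programme T: `𝔸⁴/(J₂ ⊕ J₂)` has a resolution, given a terminal model.** For
`σ = J₂ ⊕ J₂` on `k[x₀,…,x₃]` over a field of characteristic `p` and EVERY action
`ρ : ⟨σ⟩ →* Aut 𝔸⁴` with `ρ g = Spec (g⁻¹)` admitting a Király–Lütkebohmert terminal model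
(`hmodel`: a `⟨σ⟩`-equivariant proper birational regular integral `V → 𝔸⁴` with a stable affine
cover and principal stalk augmentation ideals at fixed points — the ∃-body of
`CyclicTransfer.CyclicDivisorialModelsLE`), the quotient `Spec k[x]^σ` has a resolution of
singularities: the affine quotient data (`AffineQuotient.exists_specAction`, `specAction_comp`,
`exists_specAction_base_eq`, `isFinite_`/`surjective_`/`locallyOfFiniteType_specMap_fixedPoints`,
`topologicalKrullDim_spec_fixedPoints`, generic étaleness over `D(x₀)` by
`AffineQuotient.exists_dense_etale_morphismRestrict` and `X_zero_mem_augIdeal`, `|⟨σ⟩| = p` by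
`stub_twoBlocks_order`) fed to `CyclicTransfer.cyclicDivisorialTransfer_of_card`.
[cite: KiralyLutkebohmert2013, Thm 2] [cite: SGA1, Exp. V, §1–2] -/
theorem twoJordanBlocksFourfold_hasResolution_of_model (p : ℕ) (hp : p.Prime) (k : Type) [Field k]
    [CharP k p] (σ : MvPolynomial (Fin 4) k ≃ₐ[k] MvPolynomial (Fin 4) k)
    (h0 : σ (X 0) = X 0) (h1 : σ (X 1) = X 1 + X 0)
    (h2 : σ (X 2) = X 2) (h3 : σ (X 3) = X 3 + X 2)
    (hmodel : ∀ (ρ : ↥(Subgroup.zpowers σ) →* Aut (Spec (CommRingCat.of (MvPolynomial (Fin 4) k)))),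
      (∀ g : ↥(Subgroup.zpowers σ), (ρ g).hom = Spec.map (CommRingCat.ofHom
        ((MulSemiringAction.toRingEquiv (↥(Subgroup.zpowers σ)) (MvPolynomial (Fin 4) k) g⁻¹ :
          MvPolynomial (Fin 4) k ≃+* MvPolynomial (Fin 4) k) :
            MvPolynomial (Fin 4) k →+* MvPolynomial (Fin 4) k))) →
      ∃ (V : Scheme.{0}) (π : V ⟶ Spec (CommRingCat.of (MvPolynomial (Fin 4) k)))
        (ρV : ↥(Subgroup.zpowers σ) →* Aut V), IsProper π ∧ IsBirational π ∧
        IsIntegral V ∧ Scheme.IsRegular V ∧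
        (∀ g : ↥(Subgroup.zpowers σ), (ρV g).hom ≫ π = π ≫ (ρ g).hom) ∧
        (∀ v : V, ∃ W : V.Opens, IsAffineOpen W ∧ v ∈ W ∧
          ∀ g : ↥(Subgroup.zpowers σ), (ρV g).hom ⁻¹ᵁ W = W) ∧
        ∀ (g : ↥(Subgroup.zpowers σ)) (v : V) (hv : (ρV g).hom.base v = v),
          (Ideal.span (Set.range fun s : V.presheaf.stalk v =>
            (V.presheaf.stalkSpecializes (specializes_of_eq hv) ≫ (ρV g).hom.stalkMap v).hom s -
              s)).IsPrincipal) :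
    Scheme.HasResolution
      (Spec (.of (FixedPoints.subalgebra k (MvPolynomial (Fin 4) k) (Subgroup.zpowers σ)))) := by
  classical
  haveI : Fact p.Prime := ⟨hp⟩
  obtain ⟨hσp, -, hcard⟩ := stub_twoBlocks_order p hp k σ h0 h1 h2 h3
  -- the rings: `S = k[x₀,…,x₃]`, `G = ⟨σ⟩`, `A = S^G`
  let S : Type := MvPolynomial (Fin 4) k
  let G : Type := ↥(Subgroup.zpowers σ)
  haveI : Finite G := Nat.finite_of_card_ne_zero (hcard ▸ hp.ne_zero)
  let A : Subalgebra k S := FixedPoints.subalgebra k S G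
  -- the action on `𝔸⁴` and its terminal model
  obtain ⟨ρ, hρ⟩ := AffineQuotient.exists_specAction S G
  obtain ⟨V, π, ρV, hVprop, hbir, hVint, hVreg, hequiv, hcov, hdiv⟩ := hmodel ρ hρ
  haveI := hVprop
  haveI := hVint
  -- the quotient data
  let f : Spec (.of A) ⟶ Spec (.of k) := Spec.map (CommRingCat.ofHom (algebraMap k A))
  let q : Spec (.of S) ⟶ Spec (.of A) := Spec.map (CommRingCat.ofHom (algebraMap A S))
  haveI : LocallyOfFiniteType f := AffineQuotient.locallyOfFiniteType_specMap_fixedPoints k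
  haveI : IsFinite q := AffineQuotient.isFinite_specMap_fixedPoints k
  have hsurj : Function.Surjective q.base := AffineQuotient.surjective_specMap_fixedPoints k
  have hρq : ∀ g : G, (ρ g).hom ≫ q = q := AffineQuotient.specAction_comp k ρ hρ
  have horb : ∀ x y : Spec (CommRingCat.of S), q.base x = q.base y →
      ∃ g : G, (ρ g).hom.base x = y :=
    fun x y hxy => AffineQuotient.exists_specAction_base_eq k ρ hρ x y hxy
  -- generically étale: over `D(x₀)`
  have hX0 : (X 0 : S) ∈ A := (TameTransfer.mem_fixedPoints_zpowers_iff_apply_eq σ (X 0)).mpr h0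
  have ht0 : (⟨X 0, hX0⟩ : A) ≠ 0 := fun h => MvPolynomial.X_ne_zero (0 : Fin 4)
    (congrArg Subtype.val h : ((⟨X 0, hX0⟩ : A) : S) = ((0 : A) : S))
  have hU : ∃ U : (Spec (.of A)).Opens, Dense (U : Set (Spec (.of A))) ∧ Etale (q ∣_ U) :=
    AffineQuotient.exists_dense_etale_morphismRestrict k (⟨X 0, hX0⟩ : A) ht0
      fun g hg => X_zero_mem_augIdeal p hp k σ h0 h1 h2 h3 g hg
  -- `dim X₁ = 4 > 0`
  have hdim : ¬ topologicalKrullDim (Spec (CommRingCat.of A)) ≤ 0 := by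
    rw [AffineQuotient.topologicalKrullDim_spec_fixedPoints k,
      AffineQuotient.topologicalKrullDim_spec_mvPolynomial k 4]
    norm_num
  -- the transfer
  exact CyclicTransfer.cyclicDivisorialTransfer_of_card p hp k (Spec (.of S)) (Spec (.of A)) f q G ρ
    hcard hdim hsurj hU hρq horb V π ρV hbir hVreg hequiv hcov hdiv

end Summit.ResolutionOfSingularities.ResolutionOfSingularities.Theorems.WildQuotientResolution.TwoBlocks

end
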